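import Summits.QuantumFields.YangMills.Theses.FradkinShenkerFlow
import Summits.QuantumFields.YangMills.Theses.EquipartitionCriticality
import Summits.QuantumFields.YangMills.Theses.DirichletWindow
import Summits.QuantumFields.YangMills.Theses.ConvexGribovBody

/-!
# `ClusteringToYangMills` — negative-side support (cycle 2, file 2/2): exact sufficient regularity for the adapter; burden update

Support file for crux `stmt-QuantumFields-9443`
(`Summit.QuantumFields.YangMills.Theses.FradkinShenkerFlow.ClusteringToYangMills`), extracted from the standing
disprover's work file `Cruxes/ClusteringToYangMills/Disproof.lean` (gen 2, cycle 2, §3c and §4).  Tree objects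
only, nothing posited, no `def`.  Companion of `AdapterNonSoftness` (the adapter of the merged dock line — per
`(G, r)`: H ⇒ the β-uniform shape of `LatticeGapLargeBeta` — is not a soft consequence of H).

* `rate_sacrifice` (triage r1-3's elementary lemma, `TriageAdapterBookkeeping3`, reproduced) and
  `uniformShape_of_cover`: the EXACT SUFFICIENT regularity — a COUNTABLE cover of the tail by pieces on which the
  H-shape holds uniformly in `β` yields the β-uniform shape (diagonal domination of the log-constants + rate
  sacrifice).  For the Wilson family the uncountably many pairs reduce to countably many support boxes by
  Banach–Steinhaus; the cover itself (e.g. local boundedness on compact coupling intervals; free along any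
  sequence of couplings — `uniformShape_along_sequence`; free from a structured supplier) is what a supplier
  of H must provide.
* `not_continuumLegGivenGap_of_not_clusteringToYangMills`, `not_dockInputs_of_not_clusteringToYangMills`: burden
  update — a refutation of the crux refutes `ConvexGribovBody.ContinuumLegGivenGap` (stmt-8782) and the conjunction
  adapter ∧ `XiDiverges` (8941) ∧ `CriticalityOfXiDiverges` (12318) ∧ `CriticalContinuumLimit` (8762) — the
  panel's checked dominance and dock, contraposed. [folklore]
-/

noncomputable section

open Filter Topology MeasureTheory Set
open Literature.MathematicalPhysics.AQFT Literature.MathematicalPhysics.QuantumLattice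
open Literature.MathematicalPhysics.QuantumFieldTheory
open Summit.QuantumFields.YangMills.Theses
open Summit.QuantumFields.YangMills.Theses.FradkinShenkerFlow

namespace Summit.QuantumFields.YangMills.Theorems.ClusteringToYangMills.Negative

/-! ## Rate sacrifice and the diagonal lemma (exact sufficient regularity) -/

section Cover

/-- **Rate sacrifice** (triage r1-3, `TriageAdapterBookkeeping3.rate_sacrifice`, reproduced): an a-priori bound
`|c| ≤ a` and a clustering bound with multiplicative excess `exp (Γ K)` combine into the `Γ`-free constant
`a · w · exp K` at the slower rate `μ / max 1 Γ`. [folklore] -/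
theorem rate_sacrifice {a w K Γ μ x c : ℝ} (ha : 1 ≤ a) (hw : 1 ≤ w) (hK : 0 ≤ K)
    (h1 : |c| ≤ a) (h2 : |c| ≤ w * Real.exp (Γ * K) * Real.exp (-(μ * x))) :
    |c| ≤ a * w * Real.exp K * Real.exp (-(μ / max 1 Γ * x)) := by
  set L := max 1 Γ with hL
  have hL1 : 1 ≤ L := le_max_left _ _
  have hLΓ : Γ ≤ L := le_max_right _ _
  have hL0 : 0 < L := lt_of_lt_of_le one_pos hL1
  have ha0 : 0 ≤ a := le_trans zero_le_one ha
  have haw : 1 ≤ a * w := by nlinarith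
  by_cases h : μ * x ≤ L * K
  · have hle : μ / L * x ≤ K := by
      rw [div_mul_eq_mul_div, div_le_iff₀ hL0]; linarith [mul_comm L K]
    have hone : 1 ≤ Real.exp K * Real.exp (-(μ / L * x)) := by
      rw [← Real.exp_add]; exact Real.one_le_exp (by linarith)
    calc |c| ≤ a := h1
      _ ≤ a * w := by nlinarith
      _ = a * w * 1 := (mul_one _).symm
      _ ≤ a * w * (Real.exp K * Real.exp (-(μ / L * x))) := by
          exact mul_le_mul_of_nonneg_left hone (by linarith)
      _ = a * w * Real.exp K * Real.exp (-(μ / L * x)) := by ring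
  · push Not at h
    have h3 : K < μ * x / L := by rw [lt_div_iff₀ hL0]; linarith
    have h4 : K * (L - 1) ≤ μ * x / L * (L - 1) :=
      mul_le_mul_of_nonneg_right h3.le (by linarith)
    have h5 : K * Γ ≤ K * L := mul_le_mul_of_nonneg_left hLΓ hK
    have h7 : μ * x / L * (L - 1) = μ * x - μ * x / L := by
      field_simp
    have h6 : μ / L * x = μ * x / L := by ring
    have key : Γ * K + -(μ * x) ≤ K + -(μ / L * x) := by
      rw [h6]; rw [h7] at h4; nlinarith [h4, h5]
    calc |c| ≤ w * Real.exp (Γ * K) * Real.exp (-(μ * x)) := h2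
      _ = w * Real.exp (Γ * K + -(μ * x)) := by rw [Real.exp_add]; ring
      _ ≤ w * Real.exp (K + -(μ / L * x)) :=
          mul_le_mul_of_nonneg_left (Real.exp_le_exp.2 key) (by linarith)
      _ = 1 * w * (Real.exp K * Real.exp (-(μ / L * x))) := by rw [Real.exp_add]; ring
      _ ≤ a * w * (Real.exp K * Real.exp (-(μ / L * x))) := by
          apply mul_le_mul_of_nonneg_right _ (by positivity)
          exact mul_le_mul_of_nonneg_right ha (by linarith)
      _ = a * w * Real.exp K * Real.exp (-(μ / L * x)) := by ring

/-- **Diagonal lemma (exact sufficient regularity for the adapter).** For an a priori bounded family of pair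
correlations `f j β S n`: if a tail `[β₁, ∞)` is a COUNTABLE union of pieces `X k` on each of which the H-shape
bound holds UNIFORMLY in `β` (common rate `μ_k > 0`, per-pair constants), then the β-uniform shape holds on the
tail (β-free per-pair constants, one rate function, NO volume thresholds — stronger than the `LatticeGapLargeBeta` shape).  Proof: `Φ k j := log⁺ C_{k j}` is
dominated by the product `ν_k · b_j` (`b_j := 1 + Σ_{k ≤ j} Φ k j`, `ν_k := 1 + Σ_{j < k} Φ k j`), then rate
sacrifice.  For the Wilson family the uncountably many pairs reduce to countably many support boxes by
Banach–Steinhaus; the cover itself (e.g. local boundedness of the constants on compact coupling intervals) is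
the β-regularity a supplier of H must provide. [folklore] -/
theorem uniformShape_of_cover {f : ℕ → ℝ → ℕ → ℕ → ℝ} {a : ℕ → ℝ} (ha : ∀ j β S n, |f j β S n| ≤ a j)
    {β₁ : ℝ} {X : ℕ → Set ℝ} (hcov : ∀ β : ℝ, β₁ ≤ β → ∃ k, β ∈ X k)
    (hunif : ∀ k : ℕ, ∃ μ : ℝ, 0 < μ ∧ ∀ j : ℕ, ∃ C : ℝ, ∀ β ∈ X k, ∀ S n : ℕ, n ≤ S →
      |f j β S n| ≤ C * Real.exp (-(μ * n))) :
    ∃ m : ℝ → ℝ, (∀ β : ℝ, β₁ ≤ β → 0 < m β) ∧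
      ∀ j : ℕ, ∃ C : ℝ, ∀ β : ℝ, β₁ ≤ β → ∀ S n : ℕ, n ≤ S →
        |f j β S n| ≤ C * Real.exp (-(m β * n)) := by
  choose μ hμ C hC using hunif
  choose kk hkk using hcov
  set Φ : ℕ → ℕ → ℝ := fun k j => Real.log (max 1 (C k j)) with hΦ
  have hΦ0 : ∀ k j, 0 ≤ Φ k j := fun k j => Real.log_nonneg (le_max_left _ _)
  have hCΦ : ∀ k j, C k j ≤ Real.exp (Φ k j) := fun k j => by
    simp only [hΦ]
    rw [Real.exp_log (lt_of_lt_of_le one_pos (le_max_left _ _))]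
    exact le_max_right _ _
  set b : ℕ → ℝ := fun j => 1 + ∑ k ∈ Finset.range (j + 1), Φ k j with hb
  set ν : ℕ → ℝ := fun k => 1 + ∑ j ∈ Finset.range k, Φ k j with hν
  have hb1 : ∀ j, 1 ≤ b j := fun j => by
    have := Finset.sum_nonneg (s := Finset.range (j + 1)) (fun k _ => hΦ0 k j)
    simp only [hb]; linarith
  have hν1 : ∀ k, 1 ≤ ν k := fun k => by
    have := Finset.sum_nonneg (s := Finset.range k) (fun j _ => hΦ0 k j)
    simp only [hν]; linarith
  have hdom : ∀ k j, Φ k j ≤ ν k * b j := by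
    intro k j
    rcases le_or_gt k j with hkj | hjk
    · have h1 : Φ k j ≤ ∑ k' ∈ Finset.range (j + 1), Φ k' j :=
        Finset.single_le_sum (f := fun k' => Φ k' j) (fun k' _ => hΦ0 k' j)
          (Finset.mem_range.2 (Nat.lt_succ_of_le hkj))
      have h2 : Φ k j ≤ b j := by simp only [hb]; linarith
      calc Φ k j ≤ b j := h2
        _ = 1 * b j := (one_mul _).symm
        _ ≤ ν k * b j := mul_le_mul_of_nonneg_right (hν1 k) (le_trans zero_le_one (hb1 j))
    · have h1 : Φ k j ≤ ∑ j' ∈ Finset.range k, Φ k j' :=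
        Finset.single_le_sum (f := fun j' => Φ k j') (fun j' _ => hΦ0 k j') (Finset.mem_range.2 hjk)
      have h2 : Φ k j ≤ ν k := by simp only [hν]; linarith
      calc Φ k j ≤ ν k := h2
        _ = ν k * 1 := (mul_one _).symm
        _ ≤ ν k * b j := mul_le_mul_of_nonneg_left (hb1 j) (le_trans zero_le_one (hν1 k))
  refine ⟨fun β => if h : β₁ ≤ β then μ (kk β h) / max 1 (ν (kk β h)) else 1, ?_, ?_⟩
  · intro β hβ
    simp only [hβ, ↓reduceDIte]
    exact div_pos (hμ _) (lt_of_lt_of_le one_pos (le_max_left _ _))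
  · intro j
    refine ⟨max 1 (a j) * 1 * Real.exp (b j), fun β hβ S n hn => ?_⟩
    have hβk : β ∈ X (kk β hβ) := hkk β hβ
    have h1 : |f j β S n| ≤ max 1 (a j) := (ha j β S n).trans (le_max_right _ _)
    have h2 : |f j β S n| ≤ 1 * Real.exp (ν (kk β hβ) * b j) * Real.exp (-(μ (kk β hβ) * n)) := by
      rw [one_mul]
      calc |f j β S n| ≤ C (kk β hβ) j * Real.exp (-(μ (kk β hβ) * n)) := hC _ j β hβk S n hn
        _ ≤ Real.exp (Φ (kk β hβ) j) * Real.exp (-(μ (kk β hβ) * n)) :=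
            mul_le_mul_of_nonneg_right (hCΦ _ j) (Real.exp_pos _).le
        _ ≤ Real.exp (ν (kk β hβ) * b j) * Real.exp (-(μ (kk β hβ) * n)) :=
            mul_le_mul_of_nonneg_right (Real.exp_le_exp.2 (hdom _ j)) (Real.exp_pos _).le
    have := rate_sacrifice (le_max_left _ _) le_rfl (le_trans zero_le_one (hb1 j)) h1 h2
    simpa only [hβ, ↓reduceDIte] using this


/-- **Along any SEQUENCE of couplings the uniform shape is free** (corollary of `uniformShape_of_cover` with the
pieces `{β | ⌊β⌋₊ = k}`; = triage r1-2's `sequential_uniformise`): per-index H-shape bounds with index-dependent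
constants upgrade to index-free per-pair constants at a sacrificed, still positive, rate `m_k`.  This is the
form in which Clay-as-typed consumes uniformity (`HasLatticeMassGap`: `∀ A B ∃ C ∀ᶠ k`), and the reason the
panel recommends typing the hub's torus clause along `β_k → ∞`. [folklore] -/
theorem uniformShape_along_sequence {g : ℕ → ℕ → ℕ → ℕ → ℝ} {a : ℕ → ℝ}
    (ha : ∀ j k S n, |g j k S n| ≤ a j)
    (hH : ∀ k : ℕ, ∃ μ : ℝ, 0 < μ ∧ ∀ j : ℕ, ∃ C : ℝ, ∀ S n : ℕ, n ≤ S →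
      |g j k S n| ≤ C * Real.exp (-(μ * n))) :
    ∃ m : ℕ → ℝ, (∀ k, 0 < m k) ∧ ∀ j : ℕ, ∃ C : ℝ, ∀ k S n : ℕ, n ≤ S →
      |g j k S n| ≤ C * Real.exp (-(m k * n)) := by
  have hcov : ∀ β : ℝ, (0 : ℝ) ≤ β → ∃ k, β ∈ {β' : ℝ | ⌊β'⌋₊ = k} := fun β _ => ⟨⌊β⌋₊, rfl⟩
  have hunif : ∀ k : ℕ, ∃ μ : ℝ, 0 < μ ∧ ∀ j : ℕ, ∃ C : ℝ, ∀ β ∈ {β' : ℝ | ⌊β'⌋₊ = k}, ∀ S n : ℕ,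
      n ≤ S → |g j ⌊β⌋₊ S n| ≤ C * Real.exp (-(μ * n)) := by
    intro k
    obtain ⟨μ, hμ, hC⟩ := hH k
    refine ⟨μ, hμ, fun j => ?_⟩
    obtain ⟨C, hC⟩ := hC j
    refine ⟨C, fun β hβ S n hn => ?_⟩
    rw [Set.mem_setOf_eq] at hβ
    rw [hβ]
    exact hC S n hn
  obtain ⟨m, hm, hC⟩ := uniformShape_of_cover (f := fun j β S n => g j ⌊β⌋₊ S n)
    (fun j β S n => ha j _ S n) hcov hunif
  refine ⟨fun k => m k, fun k => hm k (Nat.cast_nonneg k), fun j => ?_⟩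
  obtain ⟨C, hC⟩ := hC j
  refine ⟨C, fun k S n hn => ?_⟩
  have := hC k (Nat.cast_nonneg k) S n hn
  simpa only [Nat.floor_natCast] using this

end Cover

/-! ## Burden update through the panel's certified docks -/

section Burden

/-- **A refutation of the crux refutes the shared existence leg `ContinuumLegGivenGap`** (stmt-QuantumFields-8782;
the panel's checked dominance 8782 ⇒ 9443 by `S₁ := 0`, contraposed). [folklore] -/
theorem not_continuumLegGivenGap_of_not_clusteringToYangMills (h : ¬ ClusteringToYangMills) :
    ¬ ConvexGribovBody.ContinuumLegGivenGap := by
  intro h8782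
  refine h fun hEC G _ _ _ _ hG => ?_
  letI : MeasurableSpace G := borel G
  haveI : BorelSpace G := ⟨rfl⟩
  refine h8782 G hG (fun r => ?_)
  obtain ⟨β₀, hβ₀⟩ := hEC G hG r
  refine ⟨β₀, fun β hβ => ?_⟩
  obtain ⟨m, hm, hAB⟩ := hβ₀ β hβ
  exact ⟨m, hm, 0, fun A B => (hAB A B).imp fun C hC S n _ hn => hC S n hn⟩

/-- **A refutation of the crux refutes one of the dock inputs**: the adapter (per `(G, r)`: H ⇒ the β-uniform
shape), `XiDiverges` (stmt-8941), `CriticalityOfXiDiverges` (stmt-12318), `CriticalContinuumLimit` (stmt-8762)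
(the panel's checked dock, contraposed). [folklore] -/
theorem not_dockInputs_of_not_clusteringToYangMills (h : ¬ ClusteringToYangMills) :
    ¬ ((∀ (G : Type) [Group G] [TopologicalSpace G] [IsTopologicalGroup G] [CompactSpace G]
          [MeasurableSpace G] [BorelSpace G], IsCompactSimpleLieGroup G → ∀ r : LatticeRep G,
          (∃ β₀ : ℝ, ∀ β : ℝ, β₀ ≤ β → (∃ m : ℝ, 0 < m ∧ ∀ A B : YMSpecies G, ∃ C : ℝ, ∀ S n : ℕ, n ≤ S →
            |latticeConnectedCorr r.ρ β (2 * S + 1) A.F B.F n| ≤ C * Real.exp (-(m * n)))) →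
          ∃ (β₁ : ℝ) (m : ℝ → ℝ) (S₀ : ℝ → ℕ), (∀ β : ℝ, β₁ ≤ β → 0 < m β) ∧
            ∀ A B : YMSpecies G, ∃ C : ℝ, ∀ β : ℝ, β₁ ≤ β → ∀ S n : ℕ, S₀ β ≤ S → n ≤ S →
              |latticeConnectedCorr r.ρ β (2 * S + 1) A.F B.F n| ≤ C * Real.exp (-(m β * n))) ∧
        DirichletWindow.XiDiverges ∧ DirichletWindow.CriticalityOfXiDiverges ∧
        EquipartitionCriticality.CriticalContinuumLimit) := by
  rintro ⟨hU, hXi, hCrit, hCCL⟩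
  refine h fun hH G _ _ _ _ hG => ?_
  letI : MeasurableSpace G := borel G
  haveI : BorelSpace G := ⟨rfl⟩
  exact hCCL G hG (fun r => hU G hG r (hH G hG r)) (hCrit hXi G hG)

end Burden

end Summit.QuantumFields.YangMills.Theorems.ClusteringToYangMills.Negative

end
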